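import Mathlib.AlgebraicGeometry.Group.Abelian
import HarnessLib

-- provenance: harness21/H21/H21/Statements/Hodge/Wave0.lean @ ca58313 (interim HEAD d8f2665); M5 mechanical rewrite
/-!
# Hodge family — wave 0 statements

Family `hodge` (Hodge conjecture and its satellites), gap inventory 2026-08-12.

## Covered statement ids

* **hodge.S35** — a proper geometrically integral group scheme over a field (an abelian
  variety) is commutative (Mumford, *Abelian Varieties*, §4 (ii)). This is already a Mathlib
  theorem, `AlgebraicGeometry.isCommMonObj_of_isProper_of_geometricallyIntegral`; we package the
  hypotheses as a `Prop`-valued structure `IsAbelianVariety` and restate the result for it, with a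
  genuine proof. The second half of the inventory item ("abelian varieties are projective",
  Mumford §6) is *not* stated: projective morphisms / ample line bundles on schemes are absent
  from Mathlib v4.32.0 (inventory: "not statable: projective morphisms absent").

## Skipped statement ids

* hodge.S01–S34: marked `statable_today: false` in the inventory (they need Betti/Dolbeault
  cohomology, Hodge structures, Chow groups, cycle class maps, étale cohomology, …, none of which
  exist in Mathlib v4.32.0).

## Design choices

* A group scheme over a field `K` is, as in `Mathlib.AlgebraicGeometry.Group.Abelian`, an object
  `G : Over (Spec (.of K))` equipped with a `GrpObj G` instance for the cartesian monoidal
  structure on the over category.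
* `IsAbelianVariety G` bundles the two hypotheses *proper* and *geometrically integral* of the
  structure morphism. Smoothness is not required: a geometrically reduced group scheme locally
  of finite type over a field is automatically smooth (Stacks 047N), so this agrees with the usual
  definition (Mumford; Stacks 0BF9 / 0H2R).
-/

namespace Literature.AlgebraicGeometry.Motives

open CategoryTheory _root_.AlgebraicGeometry

universe u

variable {K : Type u} [Field K]

/-- An *abelian variety* over a field `K`: a group scheme `G → Spec K` (an object of the over
category carrying a `GrpObj` structure) whose structure morphism is proper and geometrically
integral. Reference: Mumford, *Abelian Varieties*, §4; Stacks Project, Tag 0BF9. [folklore] -/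
structure IsAbelianVariety (G : Over (Spec (.of K))) [GrpObj G] : Prop where
  /-- The structure morphism `G → Spec K` is proper. -/
  isProper : IsProper G.hom
  /-- The structure morphism `G → Spec K` is geometrically integral. -/
  geometricallyIntegral : GeometricallyIntegral G.hom

/-- **hodge.S35** (abelian varieties are commutative; Mumford, *Abelian Varieties*, §4 (ii);
Stacks Project, Tag 0BFD). A proper geometrically integral group scheme over a field — i.e. an
abelian variety — is a commutative group scheme. This is Mathlib's
`AlgebraicGeometry.isCommMonObj_of_isProper_of_geometricallyIntegral`. (The companion assertion
"abelian varieties are projective", Mumford §6, is not statable in Mathlib v4.32.0.) [folklore] -/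
theorem IsAbelianVariety.isCommMonObj {G : Over (Spec (.of K))} [GrpObj G]
    (hG : IsAbelianVariety G) : IsCommMonObj G := by
  have := hG.isProper
  have := hG.geometricallyIntegral
  exact isCommMonObj_of_isProper_of_geometricallyIntegral G

end Literature.AlgebraicGeometry.Motives
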